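import Literature.Analysis.FluidPDE.PassiveScalarDiagEnergyEquality
import Literature.Analysis.FluidPDE.TransportWeakExistenceProofs
import HarnessLib

/-!
# The energy equality at EVERY time for a weakly continuous representative of a weak passive
# scalar with constant diagonal diffusion, bounded drift and an `L¹_t L²_x` source

Analysis/FluidPDE proof file (everything proved; no definitions, no named facts). The energy
equality of `PassiveScalarDiagEnergyEquality` (`IsWeakScalarTransportDiagForcedOn.energy_eq`,
Bonicatto–Ciampa–Crippa 2024, Thm. 3.3 / (3.4) / Remark 3.4 at the corner `p = ∞`, `q = 2`, for the
constant diagonal diffusion `κ ∑ᵢ aᵢ ∂ᵢ∂ᵢ` of a rectangular flat torus written on the unit torus and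
with a source) holds for a.e. `t ∈ (0,T)` only, because a weak solution `θ ∈ L^∞_t L²_x`
(`Torus.IsWeakScalarTransportDiagForcedOn`) is determined for a.e. `t` only. Here we prove it at
EVERY `t ∈ [0,T]` — endpoint `t = T` included — for any field `w` which agrees with `θ` at a.e. time,
has `L²` slices on `[0,T]`, and whose Fourier coefficients `t ↦ 𝓕(w(t))(k)` are continuous on
`[0,T]` (e.g. the weakly continuous representative of `PassiveScalarDiagForcedTrace`):

* `IsWeakScalarTransportDiagForcedOn.galerkin_energy_eq_of_representative` — the truncated
  (Galerkin) identity `∑_{|k|≤N} |ŵ(t)(k)|² = ∑_{|k|≤N} |θ̂₀(k)|² + 2∫₀ᵗ(remainder) - 2κ∫₀ᵗ‖∇P_Nθ‖²_a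
  + 2∫₀ᵗ∫ s P_Nθ` at EVERY `t ∈ [0,T]` (both sides are continuous in `t`, equal a.e. by
  `ae_galerkin_energy_eq_remainder`);
* `IsWeakScalarTransportDiagForcedOn.energy_eq_of_representative` — for EVERY `t ∈ [0,T]`,
  `‖w(t)‖²_{L²} + 2κ ∫₀ᵗ ‖∇θ‖²_a = ‖θ₀‖²_{L²} + 2 ∫₀ᵗ ∫ s θ` (`‖∇θ‖²_a = Torus.eScalarGradNormSqDiag a θ`);
  the passage `N → ∞` is the one of `energy_eq`, with the limits of the Galerkin terms now taken on
  `(0,t)` for every `t ≤ T` (`tendsto_integral_galerkin_source_of_le`,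
  `tendsto_integral_galerkin_remainder_of_le`);
* `IsWeakScalarTransportDiagForcedOn.continuousOn_mFourierCoeff_of_weaklyContinuous` — continuity of
  the Fourier coefficients from weak continuity in `L²` (pairings with the cosine / sine modes).

This is the time-pointwise half of the Lions–Magenes / Temam lemma (`u ∈ L²(V)`, `u' ∈ L²(V')` ⇒
`u ∈ C([0,T];H)` with `d/dt |u|² = 2⟨u', u⟩`, Temam 1979, Ch. III §1, Lemma 1.2) for this class,
obtained by Fourier–Galerkin rather than by mollification in time; the strong `L²`-continuity of the
representative (Radon–Riesz) is `PassiveScalarDiagEnergyContinuity`.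

## Mathlib / tree search

Tree (reused): `ae_galerkin_energy_eq_remainder`, `exists_integral_galerkin_diss_le`,
`lintegral_eScalarGradNormSqDiag_eq_iSup`, `tendsto_integral_galerkin_tail`,
`exists_ae_abs_galerkin_remainder_le`, `ae_abs_galerkin_source_le` (`PassiveScalarDiagEnergy`,
`…GalerkinBounds`), `re_mFourierCoeff_ofReal` / `im_mFourierCoeff_ofReal`,
`hasSum_sq_norm_mFourierCoeff_ofReal` (`TorusScalarTrigPoly`), `mFourierCoeff_congr_ae`; Mathlib
`Measure.eqOn_Icc_of_ae_eq`, `intervalIntegral.continuousOn_primitive`,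
`integral_mul_le_Lp_mul_Lq_of_nonneg`.

## References

* P. Bonicatto, G. Ciampa, G. Crippa, J. Evol. Equ. 24 (2024), Paper No. 1 (arXiv:2306.15529),
  Thm. 3.3, (3.4), Remark 3.4. [`BonicattoCiampaCrippa2023`]
* R. Temam, *Navier–Stokes Equations* (North-Holland 1979), Ch. III §1, Lemma 1.2. [`Temam1979`]
* J. C. Robinson, J. L. Rodrigo, W. Sadowski, *The three-dimensional Navier–Stokes equations*
  (CUP 2016), §4.2, Thm. 4.11. [`RobinsonRodrigoSadowski2016`]
* L. Grafakos, *Classical Fourier Analysis*, 3rd ed. (2014), §3.1.1, Prop. 3.2.7. [`Grafakos2014`]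
-/

noncomputable section

open _root_.MeasureTheory _root_.Set _root_.Filter _root_.Function _root_.TopologicalSpace
open scoped ENNReal NNReal InnerProductSpace ContDiff Topology
open Literature.Analysis.FunctionSpaces.Torus Literature.Analysis.FunctionSpaces UnitAddTorus

namespace Literature.Analysis.FluidPDE

variable {d : Type*} [Fintype d] [DecidableEq d]

/-! ## Tools -/

section Tools

omit [Fintype d] [DecidableEq d] in
/-- Two functions continuous on `[0,T]` that agree for a.e. `t ∈ (0,T)` agree on `[0,T]`
(`T > 0`). [folklore] -/
private theorem eqOn_Icc_of_ae_Ioo {Y : Type*} [TopologicalSpace Y] [T2Space Y] {T : ℝ}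
    (hT : 0 < T) {f g : ℝ → Y} (hf : ContinuousOn f (Icc 0 T)) (hg : ContinuousOn g (Icc 0 T))
    (h : ∀ᵐ t ∂(volume.restrict (Ioo 0 T)), f t = g t) : EqOn f g (Icc 0 T) := by
  refine Measure.eqOn_Icc_of_ae_eq (μ := volume) hT.ne ?_ hf hg
  have e : (volume : Measure ℝ).restrict (Icc 0 T) = volume.restrict (Ioo 0 T) :=
    Measure.restrict_congr_set Ioo_ae_eq_Icc.symm
  rw [e]
  exact h

omit [Fintype d] [DecidableEq d] in
/-- The primitive `t ↦ ∫_{(0,t]} f` of a function integrable on `(0,T)` is continuous on `[0,T]`.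
[folklore] -/
private theorem continuousOn_primitive_Ioc {T : ℝ} {f : ℝ → ℝ} (hf : IntegrableOn f (Ioo 0 T) volume) :
    ContinuousOn (fun t => ∫ τ in Ioc 0 t, f τ) (Icc 0 T) :=
  intervalIntegral.continuousOn_primitive (hf.congr_set_ae Ioo_ae_eq_Icc.symm)

omit [Fintype d] [DecidableEq d] in
/-- **Cauchy–Schwarz for square roots**: `∫ √f √g ≤ √(∫ f) √(∫ g)` for nonnegative integrable
`f, g`. [folklore] -/
private theorem cs_integral_sqrt_mul_sqrt {α : Type*} [MeasurableSpace α] {μ : Measure α} {f g : α → ℝ}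
    (hf : Integrable f μ) (hg : Integrable g μ) (hf0 : 0 ≤ᵐ[μ] f) (hg0 : 0 ≤ᵐ[μ] g) :
    ∫ x, Real.sqrt (f x) * Real.sqrt (g x) ∂μ ≤ Real.sqrt (∫ x, f x ∂μ) * Real.sqrt (∫ x, g x ∂μ) := by
  have hmem : ∀ {φ : α → ℝ}, Integrable φ μ → 0 ≤ᵐ[μ] φ →
      MemLp (fun x => Real.sqrt (φ x)) (ENNReal.ofReal 2) μ := by
    intro φ hφ hφ0
    rw [show ENNReal.ofReal 2 = 2 by simp]
    refine (memLp_two_iff_integrable_sq (Real.continuous_sqrt.comp_aestronglyMeasurable hφ.1)).2 ?_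
    refine hφ.congr ?_
    filter_upwards [hφ0] with x hx
    rw [Real.sq_sqrt hx]
  have h := integral_mul_le_Lp_mul_Lq_of_nonneg Real.HolderConjugate.two_two
    (Eventually.of_forall fun x => Real.sqrt_nonneg (f x)) (Eventually.of_forall fun x => Real.sqrt_nonneg (g x))
    (hmem hf hf0) (hmem hg hg0)
  have e : ∀ {φ : α → ℝ}, 0 ≤ᵐ[μ] φ →
      (∫ x, Real.sqrt (φ x) ^ (2 : ℝ) ∂μ) ^ (1 / (2 : ℝ)) = Real.sqrt (∫ x, φ x ∂μ) := by
    intro φ hφ0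
    rw [Real.sqrt_eq_rpow]
    congr 1
    refine integral_congr_ae ?_
    filter_upwards [hφ0] with x hx
    rw [Real.rpow_two, Real.sq_sqrt hx]
  rwa [e hf0, e hg0] at h

omit [DecidableEq d] in
/-- Positive coefficients on a finite index type are bounded below by a positive constant. [folklore] -/
private theorem exists_pos_le_coeff {a : d → ℝ} (ha : ∀ i, 0 < a i) : ∃ m : ℝ, 0 < m ∧ ∀ i, m ≤ a i := by
  classical
  rcases isEmpty_or_nonempty d with hd | hd
  · exact ⟨1, one_pos, fun i => (IsEmpty.false i).elim⟩
  · obtain ⟨i₀, -, hi₀⟩ := Finset.exists_min_image Finset.univ a Finset.univ_nonempty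
    exact ⟨a i₀, ha i₀, fun i => hi₀ i (Finset.mem_univ _)⟩

end Tools

namespace Torus

namespace IsWeakScalarTransportDiagForcedOn

variable {T κ : ℝ} {a : d → ℝ} {u : ℝ → UnitAddTorus d → EuclideanSpace ℝ d} {s : ℝ → UnitAddTorus d → ℝ}
  {θ₀ : UnitAddTorus d → ℝ} {θ : ℝ → UnitAddTorus d → ℝ}

/-! ## Limits of the Galerkin terms on `(0,t)` for every `t ≤ T` -/

/-- **The integrated Galerkin source pairing converges on every initial interval**: for `t ≤ T`,
`∫_{(0,t)} ∫ s P_N θ → ∫_{(0,t)} ∫ s θ` as `N → ∞` (dominated convergence with the bound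
`√(∫ s²) √C`; the version of `tendsto_integral_galerkin_source` including `t = T`).
[cite: RobinsonRodrigoSadowski2016, §4.2 (Galerkin energy estimate)] -/
theorem tendsto_integral_galerkin_source_of_le (h : IsWeakScalarTransportDiagForcedOn T a κ u s θ₀ θ)
    (hs : ∫⁻ t in Ioo 0 T, (∫⁻ x, ‖s t x‖ₑ ^ 2) ^ (1 / 2 : ℝ) < ⊤) {t : ℝ} (ht : t ≤ T) :
    Tendsto (fun N => ∫ τ in Ioo 0 t, ∫ x, s τ x * scalarTruncate N (θ τ) x) atTop
      (𝓝 (∫ τ in Ioo 0 t, ∫ x, s τ x * θ τ x)) := by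
  obtain ⟨C, hC0, hC⟩ := h.exists_ae_integral_sq_le
  have hsub : Ioo 0 t ⊆ Ioo 0 T := Ioo_subset_Ioo_right ht
  refine tendsto_integral_of_dominated_convergence (μ := volume.restrict (Ioo 0 t))
    (fun τ => Real.sqrt (∫ x, s τ x ^ 2) * Real.sqrt C)
    (fun N => ((h.integrableOn_galerkin_source N).mono_set hsub).aestronglyMeasurable)
    ((show IntegrableOn (fun τ => Real.sqrt (∫ x, s τ x ^ 2) * Real.sqrt C) (Ioo 0 T) volume from
      (h.integrableOn_sqrt_integral_sq_source hs).mul_const _).mono_set hsub) (fun N => ?_) ?_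
  · refine ae_restrict_of_ae_restrict_of_subset hsub ?_
    filter_upwards [h.ae_abs_galerkin_source_le hs, hC] with τ hτ hτC
    rw [Real.norm_eq_abs]
    exact (hτ N).1.trans (mul_le_mul_of_nonneg_left (Real.sqrt_le_sqrt hτC) (Real.sqrt_nonneg _))
  · refine ae_restrict_of_ae_restrict_of_subset hsub ?_
    filter_upwards [h.ae_abs_galerkin_source_le hs, h.ae_galerkin_tail] with τ hτ htail
    rw [tendsto_iff_norm_sub_tendsto_zero]
    have h0 : Tendsto (fun N => Real.sqrt (∫ x, s τ x ^ 2) *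
        Real.sqrt (∫ x, (θ τ x - scalarTruncate N (θ τ) x) ^ 2)) atTop (𝓝 0) := by
      have := (Real.continuous_sqrt.tendsto 0).comp htail.2.2
      rw [Real.sqrt_zero] at this
      simpa using this.const_mul (Real.sqrt (∫ x, s τ x ^ 2))
    exact squeeze_zero (fun N => norm_nonneg _) (fun N => by rw [Real.norm_eq_abs]; exact (hτ N).2) h0

/-- **The integrated transport remainder tends to zero on every initial interval**: for `t ≤ T`,
`∫_{(0,t)} ∫ (θ - P_N θ)⟪u, ∇P_N θ⟫ → 0` as `N → ∞` (Cauchy–Schwarz in space and time with the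
uniform truncated-dissipation bound of the first pass and the vanishing Parseval tails; the version
of `tendsto_integral_galerkin_remainder` including `t = T`).
[cite: BonicattoCiampaCrippa2023, Thm. 3.3 (proof: the commutator term vanishes)] -/
theorem tendsto_integral_galerkin_remainder_of_le (h : IsWeakScalarTransportDiagForcedOn T a κ u s θ₀ θ)
    (hκ : 0 < κ) (ha : ∀ i, 0 < a i) (hθ₀ : MemLp θ₀ 2 volume)
    (hu : MemLp (stLift u) ⊤ (volume.restrict (Ioo 0 T ×ˢ univ)))
    (hs : ∫⁻ t in Ioo 0 T, (∫⁻ x, ‖s t x‖ₑ ^ 2) ^ (1 / 2 : ℝ) < ⊤) {t : ℝ} (ht : t ≤ T) :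
    Tendsto (fun N => ∫ τ in Ioo 0 t, ∫ x, (θ τ x - scalarTruncate N (θ τ) x) *
      ⟪u τ x, gradient (scalarTruncate N (θ τ)) x⟫_ℝ) atTop (𝓝 0) := by
  obtain ⟨m, hm, hma⟩ := exists_pos_le_coeff ha
  obtain ⟨Cu, hCu0, hR⟩ := h.exists_ae_abs_galerkin_remainder_le hu
  obtain ⟨K, hK0, hK⟩ := h.exists_integral_galerkin_diss_le hκ ha hθ₀ hu hs
  have hsub : Ioo 0 t ⊆ Ioo 0 T := Ioo_subset_Ioo_right ht
  have hsm : 0 < Real.sqrt m := Real.sqrt_pos.2 hm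
  -- the tails
  set ε : ℕ → ℝ := fun N => ∫ τ in Ioo 0 T, ∫ x, (θ τ x - scalarTruncate N (θ τ) x) ^ 2 with hε
  have hε0 : Tendsto ε atTop (𝓝 0) := h.tendsto_integral_galerkin_tail
  -- the bound `b N = (Cu/√m) √(ε N) √K → 0`
  have hb : Tendsto (fun N => Cu / Real.sqrt m * (Real.sqrt (ε N) * Real.sqrt K)) atTop (𝓝 0) := by
    have h1 := ((Real.continuous_sqrt.tendsto 0).comp hε0).mul_const (Real.sqrt K)
    rw [Real.sqrt_zero, zero_mul] at h1
    simpa using h1.const_mul (Cu / Real.sqrt m)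
  refine squeeze_zero_norm (fun N => ?_) hb
  -- pointwise: `‖R‖ ≤ (Cu/√m) √e2 √D`
  have hDnn : ∀ (N : ℕ) (τ : ℝ), 0 ≤ 4 * Real.pi ^ 2 * ∑ k ∈ freqBall N,
      Torus.diagSymbol a k * ‖mFourierCoeff (fun x => (θ τ x : ℂ)) k‖ ^ 2 := fun N τ =>
    mul_nonneg (by positivity) (Finset.sum_nonneg fun k _ =>
      mul_nonneg (Torus.diagSymbol_nonneg (fun i => (ha i).le) k) (sq_nonneg _))
  have henn : ∀ (N : ℕ) (τ : ℝ), 0 ≤ ∫ x, (θ τ x - scalarTruncate N (θ τ) x) ^ 2 := fun N τ =>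
    integral_nonneg fun x => sq_nonneg _
  have hei := (h.integrableOn_galerkin_tail N).mono_set hsub
  have hDi := (h.integrableOn_galerkin_diss N).mono_set hsub
  have hgi : IntegrableOn (fun τ => Cu / Real.sqrt m *
      (Real.sqrt (∫ x, (θ τ x - scalarTruncate N (θ τ) x) ^ 2) *
        Real.sqrt (4 * Real.pi ^ 2 * ∑ k ∈ freqBall N,
          Torus.diagSymbol a k * ‖mFourierCoeff (fun x => (θ τ x : ℂ)) k‖ ^ 2))) (Ioo 0 t) volume := by
    refine Integrable.const_mul (Integrable.mono' ((hei.add hDi).div_const 2)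
      ((Real.continuous_sqrt.comp_aestronglyMeasurable hei.aestronglyMeasurable).mul
        (Real.continuous_sqrt.comp_aestronglyMeasurable hDi.aestronglyMeasurable))
      (Eventually.of_forall fun τ => ?_)) _
    simp only [Pi.add_apply, Pi.mul_apply, Real.norm_eq_abs]
    rw [abs_of_nonneg (mul_nonneg (Real.sqrt_nonneg _) (Real.sqrt_nonneg _))]
    nlinarith [Real.sq_sqrt (henn N τ), Real.sq_sqrt (hDnn N τ),
      sq_nonneg (Real.sqrt (∫ x, (θ τ x - scalarTruncate N (θ τ) x) ^ 2) -
        Real.sqrt (4 * Real.pi ^ 2 * ∑ k ∈ freqBall N,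
          Torus.diagSymbol a k * ‖mFourierCoeff (fun x => (θ τ x : ℂ)) k‖ ^ 2))]
  calc ‖∫ τ in Ioo 0 t, ∫ x, (θ τ x - scalarTruncate N (θ τ) x) *
          ⟪u τ x, gradient (scalarTruncate N (θ τ)) x⟫_ℝ‖
      ≤ ∫ τ in Ioo 0 t, Cu / Real.sqrt m *
          (Real.sqrt (∫ x, (θ τ x - scalarTruncate N (θ τ) x) ^ 2) *
            Real.sqrt (4 * Real.pi ^ 2 * ∑ k ∈ freqBall N,
              Torus.diagSymbol a k * ‖mFourierCoeff (fun x => (θ τ x : ℂ)) k‖ ^ 2)) := by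
        refine norm_integral_le_of_norm_le hgi (ae_restrict_of_ae_restrict_of_subset hsub ?_)
        filter_upwards [hR N] with τ hτ
        rw [Real.norm_eq_abs]
        refine hτ.trans ?_
        have hG : Real.sqrt (∫ x, ‖gradient (scalarTruncate N (θ τ)) x‖ ^ 2) ≤
            Real.sqrt (4 * Real.pi ^ 2 * ∑ k ∈ freqBall N,
              Torus.diagSymbol a k * ‖mFourierCoeff (fun x => (θ τ x : ℂ)) k‖ ^ 2) / Real.sqrt m := by
          rw [le_div_iff₀ hsm, ← Real.sqrt_mul (integral_nonneg fun x => sq_nonneg _)]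
          refine Real.sqrt_le_sqrt ?_
          rw [mul_comm]
          exact mul_integral_norm_sq_gradient_scalarTruncate_le hma N (θ τ)
        calc Cu * (Real.sqrt (∫ x, (θ τ x - scalarTruncate N (θ τ) x) ^ 2) *
              Real.sqrt (∫ x, ‖gradient (scalarTruncate N (θ τ)) x‖ ^ 2))
            ≤ Cu * (Real.sqrt (∫ x, (θ τ x - scalarTruncate N (θ τ) x) ^ 2) *
              (Real.sqrt (4 * Real.pi ^ 2 * ∑ k ∈ freqBall N,
                Torus.diagSymbol a k * ‖mFourierCoeff (fun x => (θ τ x : ℂ)) k‖ ^ 2) / Real.sqrt m)) := by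
              gcongr
          _ = _ := by
              field_simp
    _ = Cu / Real.sqrt m * ∫ τ in Ioo 0 t, Real.sqrt (∫ x, (θ τ x - scalarTruncate N (θ τ) x) ^ 2) *
          Real.sqrt (4 * Real.pi ^ 2 * ∑ k ∈ freqBall N,
            Torus.diagSymbol a k * ‖mFourierCoeff (fun x => (θ τ x : ℂ)) k‖ ^ 2) := integral_const_mul _ _
    _ ≤ Cu / Real.sqrt m * (Real.sqrt (∫ τ in Ioo 0 t, ∫ x, (θ τ x - scalarTruncate N (θ τ) x) ^ 2) *
          Real.sqrt (∫ τ in Ioo 0 t, 4 * Real.pi ^ 2 * ∑ k ∈ freqBall N,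
            Torus.diagSymbol a k * ‖mFourierCoeff (fun x => (θ τ x : ℂ)) k‖ ^ 2)) :=
        mul_le_mul_of_nonneg_left (cs_integral_sqrt_mul_sqrt hei hDi (ae_of_all _ (henn N))
          (ae_of_all _ (hDnn N))) (by positivity)
    _ ≤ Cu / Real.sqrt m * (Real.sqrt (ε N) * Real.sqrt K) := by
        gcongr
        · exact setIntegral_mono_set (h.integrableOn_galerkin_tail N) (ae_of_all _ (henn N))
            hsub.eventuallyLE
        · exact (setIntegral_mono_set (h.integrableOn_galerkin_diss N) (ae_of_all _ (hDnn N))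
            hsub.eventuallyLE).trans (hK N)

/-! ## Continuity in time of Fourier coefficients from weak continuity -/

omit [DecidableEq d] in
/-- **Weak continuity gives continuous Fourier coefficients**: if `w(t) ∈ L²` on a set of times `S`
and `t ↦ ∫ w(t) g` is continuous on `S` for every `g ∈ L²(T^d)`, then every Fourier coefficient
`t ↦ 𝓕(w(t))(k)` is continuous on `S` (its real and imaginary parts are the pairings with the
cosine and sine modes, `re_mFourierCoeff_ofReal` / `im_mFourierCoeff_ofReal`). [cite: Grafakos2014, §3.1.1] -/
theorem _root_.Literature.Analysis.FluidPDE.Torus.continuousOn_mFourierCoeff_of_weaklyContinuous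
    {S : Set ℝ} {w : ℝ → UnitAddTorus d → ℝ} (hw2 : ∀ t ∈ S, MemLp (w t) 2 volume)
    (hwc : ∀ g : UnitAddTorus d → ℝ, MemLp g 2 volume → ContinuousOn (fun t => ∫ x, w t x * g x) S)
    (k : d → ℤ) : ContinuousOn (fun t => mFourierCoeff (fun x => (w t x : ℂ)) k) S := by
  have hre := hwc _ ((isSmooth_reTrigPoly {-k} fun _ => (1 : ℂ)).memLp 2)
  have him := hwc _ ((isSmooth_reTrigPoly {-k} fun _ => -Complex.I).memLp 2)
  have hF : ContinuousOn (fun t => (((∫ x, w t x * reTrigPoly {-k} (fun _ => (1 : ℂ)) x : ℝ) : ℂ) +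
      ((∫ x, w t x * reTrigPoly {-k} (fun _ => -Complex.I) x : ℝ) : ℂ) * Complex.I)) S :=
    (Complex.continuous_ofReal.comp_continuousOn hre).add
      ((Complex.continuous_ofReal.comp_continuousOn him).mul continuousOn_const)
  refine hF.congr fun t ht => ?_
  have hI : Integrable (w t) volume := (hw2 t ht).integrable one_le_two
  show mFourierCoeff (fun x => (w t x : ℂ)) k =
    (((∫ x, w t x * reTrigPoly {-k} (fun _ => (1 : ℂ)) x : ℝ) : ℂ) +
      ((∫ x, w t x * reTrigPoly {-k} (fun _ => -Complex.I) x : ℝ) : ℂ) * Complex.I)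
  rw [← re_mFourierCoeff_ofReal hI k, ← im_mFourierCoeff_ofReal hI k]
  exact (Complex.re_add_im _).symm

/-! ## The Galerkin identity at every time -/

/-- **The Galerkin energy identity at EVERY `t ∈ [0,T]` for a representative with continuous
Fourier coefficients.** If `w(t) = θ(t)` a.e. for a.e. `t ∈ (0,T)` and every `t ↦ 𝓕(w(t))(k)` is
continuous on `[0,T]`, then for every `t ∈ [0,T]` and every `N`,
`∑_{|k|≤N} |ŵ(t)(k)|² = ∑_{|k|≤N} |θ̂₀(k)|² + 2∫_{(0,t]} ∫(θ - P_Nθ)⟪u, ∇P_Nθ⟫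
   - 2κ ∫_{(0,t]} 4π² ∑ Q_a(k)|θ̂(k)|² + 2∫_{(0,t]} ∫ s P_N θ`:
both sides are continuous on `[0,T]` and agree a.e. (`ae_galerkin_energy_eq_remainder`). In
particular (`t = 0`) `𝓕(w(0)) = θ̂₀`. [cite: RobinsonRodrigoSadowski2016, §4.2 (Galerkin energy estimate) and Thm. 4.11] -/
theorem galerkin_energy_eq_of_representative (h : IsWeakScalarTransportDiagForcedOn T a κ u s θ₀ θ)
    (hT : 0 < T) (hθ₀ : Integrable θ₀ volume) (hu : MemLp (stLift u) ⊤ (volume.restrict (Ioo 0 T ×ˢ univ)))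
    {w : ℝ → UnitAddTorus d → ℝ} (hwae : ∀ᵐ t ∂(volume.restrict (Ioo 0 T)), w t =ᵐ[volume] θ t)
    (hwc : ∀ k, ContinuousOn (fun t => mFourierCoeff (fun x => (w t x : ℂ)) k) (Icc 0 T)) :
    ∀ t ∈ Icc 0 T, ∀ N : ℕ,
      ∑ k ∈ freqBall N, ‖mFourierCoeff (fun x => (w t x : ℂ)) k‖ ^ 2 =
        ∑ k ∈ freqBall N, ‖mFourierCoeff (fun x => (θ₀ x : ℂ)) k‖ ^ 2 +
        2 * (∫ τ in Ioc 0 t, ∫ x, (θ τ x - scalarTruncate N (θ τ) x) *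
          ⟪u τ x, gradient (scalarTruncate N (θ τ)) x⟫_ℝ) -
        2 * κ * (∫ τ in Ioc 0 t, 4 * Real.pi ^ 2 * ∑ k ∈ freqBall N,
          Torus.diagSymbol a k * ‖mFourierCoeff (fun x => (θ τ x : ℂ)) k‖ ^ 2) +
        2 * ∫ τ in Ioc 0 t, ∫ x, s τ x * scalarTruncate N (θ τ) x := by
  intro t ht N
  have hf : ContinuousOn (fun t => ∑ k ∈ freqBall N, ‖mFourierCoeff (fun x => (w t x : ℂ)) k‖ ^ 2)
      (Icc 0 T) := continuousOn_finsetSum _ fun k _ => ((hwc k).norm).pow 2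
  have hg : ContinuousOn (fun t => ∑ k ∈ freqBall N, ‖mFourierCoeff (fun x => (θ₀ x : ℂ)) k‖ ^ 2 +
        2 * (∫ τ in Ioc 0 t, ∫ x, (θ τ x - scalarTruncate N (θ τ) x) *
          ⟪u τ x, gradient (scalarTruncate N (θ τ)) x⟫_ℝ) -
        2 * κ * (∫ τ in Ioc 0 t, 4 * Real.pi ^ 2 * ∑ k ∈ freqBall N,
          Torus.diagSymbol a k * ‖mFourierCoeff (fun x => (θ τ x : ℂ)) k‖ ^ 2) +
        2 * ∫ τ in Ioc 0 t, ∫ x, s τ x * scalarTruncate N (θ τ) x) (Icc 0 T) :=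
    ((continuousOn_const.add (continuousOn_const.mul
      (continuousOn_primitive_Ioc (h.integrableOn_galerkin_remainder hu N)))).sub
      (continuousOn_const.mul (continuousOn_primitive_Ioc (h.integrableOn_galerkin_diss N)))).add
      (continuousOn_const.mul (continuousOn_primitive_Ioc (h.integrableOn_galerkin_source N)))
  refine eqOn_Icc_of_ae_Ioo (Y := ℝ) hT hf hg ?_ ht
  filter_upwards [h.ae_galerkin_energy_eq_remainder hθ₀ hu, hwae] with τ hτ hwτ
  have e : ∀ k, mFourierCoeff (fun x => (w τ x : ℂ)) k = mFourierCoeff (fun x => (θ τ x : ℂ)) k :=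
    fun k => mFourierCoeff_congr_ae (hwτ.mono fun x hx => by simp only [hx]) k
  simp only [e]
  exact hτ N

/-! ## The energy equality at every time -/

/-- **Energy equality at EVERY `t ∈ [0,T]` for a representative with continuous Fourier
coefficients.** For `κ > 0`, `aᵢ > 0`, `θ₀ ∈ L²`, `u ∈ L^∞((0,T) × T^d)` (weakly divergence free
for a.e. `t`, part of the class), `∫₀ᵀ ‖s(t)‖_{L²} dt < ∞`, a weak solution `θ` of
`∂ₜθ + u·∇θ = κ ∑ᵢ aᵢ ∂ᵢ∂ᵢθ + s` on `T^d × [0,T)`, and a field `w` with `w(t) ∈ L²` for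
`t ∈ [0,T]`, `w(t) = θ(t)` a.e. for a.e. `t ∈ (0,T)`, and continuous Fourier coefficients on
`[0,T]` (e.g. the weakly continuous representative): for EVERY `t ∈ [0,T]`,
`‖w(t)‖²_{L²} + 2κ ∫₀ᵗ ‖∇θ(τ)‖²_a dτ = ‖θ₀‖²_{L²} + 2 ∫₀ᵗ ∫ s θ`
(`‖∇θ‖²_a = Torus.eScalarGradNormSqDiag a θ`). Bonicatto–Ciampa–Crippa 2024, Thm. 3.3 / (3.4) /
Remark 3.4 (energy EQUALITY in the corner `p = ∞`, `q = 2`), time-pointwise for the continuous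
representative as in Temam 1979, Ch. III §1 Lemma 1.2; proof: the Galerkin identity at every `t`
(`galerkin_energy_eq_of_representative`) and the passage `N → ∞` of `energy_eq` with the limits of
the Galerkin terms on `(0,t)`, `t ≤ T`. [cite: BonicattoCiampaCrippa2023, Thm. 3.3, (3.4) and Remark 3.4] -/
theorem energy_eq_of_representative (h : IsWeakScalarTransportDiagForcedOn T a κ u s θ₀ θ)
    (hT : 0 < T) (hκ : 0 < κ) (ha : ∀ i, 0 < a i) (hθ₀ : MemLp θ₀ 2 volume)
    (hu : MemLp (stLift u) ⊤ (volume.restrict (Ioo 0 T ×ˢ univ)))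
    (hs : ∫⁻ t in Ioo 0 T, (∫⁻ x, ‖s t x‖ₑ ^ 2) ^ (1 / 2 : ℝ) < ⊤)
    {w : ℝ → UnitAddTorus d → ℝ} (hw2 : ∀ t ∈ Icc 0 T, MemLp (w t) 2 volume)
    (hwae : ∀ᵐ t ∂(volume.restrict (Ioo 0 T)), w t =ᵐ[volume] θ t)
    (hwc : ∀ k, ContinuousOn (fun t => mFourierCoeff (fun x => (w t x : ℂ)) k) (Icc 0 T)) :
    ∀ t ∈ Icc 0 T,
      (∫ x, w t x ^ 2) + 2 * κ * (∫⁻ τ in Ioo 0 t, Torus.eScalarGradNormSqDiag a (θ τ)).toReal =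
        (∫ x, θ₀ x ^ 2) + 2 * ∫ τ in Ioo 0 t, ∫ x, s τ x * θ τ x := by
  intro t htI
  have ht : t ≤ T := htI.2
  have hθ₀i : Integrable θ₀ volume := hθ₀.integrable one_le_two
  have ha' : ∀ i, 0 ≤ a i := fun i => (ha i).le
  have hid0 := h.galerkin_energy_eq_of_representative hT hθ₀i hu hwae hwc t htI
  -- the five sequences, on `(0,t)`
  set EN : ℕ → ℝ := fun N => ∑ k ∈ freqBall N, ‖mFourierCoeff (fun x => (w t x : ℂ)) k‖ ^ 2 with hEN
  set E0 : ℕ → ℝ := fun N => ∑ k ∈ freqBall N, ‖mFourierCoeff (fun x => (θ₀ x : ℂ)) k‖ ^ 2 with hE0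
  set XN : ℕ → ℝ := fun N => ∫ τ in Ioo 0 t, 4 * Real.pi ^ 2 * ∑ k ∈ freqBall N,
    Torus.diagSymbol a k * ‖mFourierCoeff (fun x => (θ τ x : ℂ)) k‖ ^ 2 with hXN
  set RN : ℕ → ℝ := fun N => ∫ τ in Ioo 0 t, ∫ x, (θ τ x - scalarTruncate N (θ τ) x) *
    ⟪u τ x, gradient (scalarTruncate N (θ τ)) x⟫_ℝ with hRN
  set SN : ℕ → ℝ := fun N => ∫ τ in Ioo 0 t, ∫ x, s τ x * scalarTruncate N (θ τ) x with hSN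
  have hid : ∀ N, EN N = E0 N + 2 * RN N - 2 * κ * XN N + 2 * SN N := by
    intro N
    have e := hid0 N
    simp only [setIntegral_congr_set (Ioo_ae_eq_Ioc (μ := (volume : Measure ℝ)) (a := 0) (b := t)).symm]
      at e
    exact e
  -- their limits
  have hENl : Tendsto EN atTop (𝓝 (∫ x, w t x ^ 2)) :=
    (hasSum_sq_norm_mFourierCoeff_ofReal (hw2 t htI)).comp tendsto_freqBall_atTop
  have hE0l : Tendsto E0 atTop (𝓝 (∫ x, θ₀ x ^ 2)) :=
    (hasSum_sq_norm_mFourierCoeff_ofReal hθ₀).comp tendsto_freqBall_atTop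
  have hSNl : Tendsto SN atTop (𝓝 (∫ τ in Ioo 0 t, ∫ x, s τ x * θ τ x)) :=
    h.tendsto_integral_galerkin_source_of_le hs ht
  have hRNl : Tendsto RN atTop (𝓝 0) := h.tendsto_integral_galerkin_remainder_of_le hκ ha hθ₀ hu hs ht
  set L : ℝ := ((∫ x, θ₀ x ^ 2) + 2 * (∫ τ in Ioo 0 t, ∫ x, s τ x * θ τ x) - ∫ x, w t x ^ 2) / (2 * κ)
    with hL
  have hXNl : Tendsto XN atTop (𝓝 L) := by
    have e : XN = fun N => (E0 N + 2 * RN N + 2 * SN N - EN N) / (2 * κ) := by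
      funext N
      have := hid N
      field_simp
      linarith
    rw [e, hL]
    have h1 := ((hE0l.add ((hRNl.const_mul 2).add (hSNl.const_mul 2))).sub hENl).div_const (2 * κ)
    have h2 : Tendsto (fun N => (E0 N + 2 * RN N + 2 * SN N - EN N) / (2 * κ)) atTop
        (𝓝 (((∫ x, θ₀ x ^ 2) + (2 * 0 + 2 * ∫ τ in Ioo 0 t, ∫ x, s τ x * θ τ x) - ∫ x, w t x ^ 2) /
          (2 * κ))) :=
      h1.congr' (Eventually.of_forall fun N => by ring)
    convert h2 using 3
    ring
  -- the truncated dissipations increase to the `A`-dissipation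
  have hXmono : Monotone XN := by
    refine monotone_nat_of_le_succ fun N => ?_
    have hsub : Ioo 0 t ⊆ Ioo 0 T := Ioo_subset_Ioo_right ht
    refine integral_mono_ae ((h.integrableOn_galerkin_diss N).mono_set hsub)
      ((h.integrableOn_galerkin_diss (N + 1)).mono_set hsub) (Eventually.of_forall fun τ => ?_)
    exact mul_le_mul_of_nonneg_left (Finset.sum_le_sum_of_subset_of_nonneg (freqBall_mono (Nat.le_succ N))
      fun k _ _ => mul_nonneg (Torus.diagSymbol_nonneg ha' k) (sq_nonneg _)) (by positivity)
  have hL0 : 0 ≤ L := by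
    refine ge_of_tendsto' hXNl fun N => ?_
    exact setIntegral_nonneg measurableSet_Ioo fun τ _ => mul_nonneg (by positivity)
      (Finset.sum_nonneg fun k _ => mul_nonneg (Torus.diagSymbol_nonneg ha' k) (sq_nonneg _))
  have hlin : (∫⁻ τ in Ioo 0 t, Torus.eScalarGradNormSqDiag a (θ τ)).toReal = L := by
    rw [h.lintegral_eScalarGradNormSqDiag_eq_iSup ha' ht]
    have hsup : ⨆ N, ENNReal.ofReal (XN N) = ENNReal.ofReal L :=
      tendsto_nhds_unique (tendsto_atTop_iSup fun N M hNM => ENNReal.ofReal_le_ofReal (hXmono hNM))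
        ((ENNReal.continuous_ofReal.tendsto L).comp hXNl)
    rw [hsup, ENNReal.toReal_ofReal hL0]
  rw [hlin, hL]
  field_simp
  ring

/-- **The slice at time `0` of a representative with continuous Fourier coefficients is the
datum**: `∫ w(0)² = ∫ θ₀²` and indeed `w(0) = θ₀` a.e. (the Galerkin identity at `t = 0` reads
`𝓕(w(0)) = θ̂₀` on every ball, and Fourier coefficients determine an `L²` function).
[cite: RobinsonRodrigoSadowski2016, Thm. 4.11] -/
theorem representative_zero_ae_eq (h : IsWeakScalarTransportDiagForcedOn T a κ u s θ₀ θ)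
    (hT : 0 < T) (hθ₀ : MemLp θ₀ 2 volume)
    {w : ℝ → UnitAddTorus d → ℝ} (hw0 : MemLp (w 0) 2 volume)
    (hwae : ∀ᵐ t ∂(volume.restrict (Ioo 0 T)), w t =ᵐ[volume] θ t)
    (hwc : ∀ k, ContinuousOn (fun t => mFourierCoeff (fun x => (w t x : ℂ)) k) (Icc 0 T)) :
    w 0 =ᵐ[volume] θ₀ := by
  have hθ₀i : Integrable θ₀ volume := hθ₀.integrable one_le_two
  -- the pairing primitives of the equation against steady smooth fields are continuous on `[0,T]`
  have hPc : ∀ {g : UnitAddTorus d → ℝ}, IsSmooth g → ContinuousOn (fun t => (∫ x, θ₀ x * g x) +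
      ∫ τ in Ioc 0 t, ((∫ x, θ τ x * (⟪u τ x, gradient g x⟫_ℝ +
        κ * ∑ i, a i * FunctionSpaces.Torus.partialDeriv i (FunctionSpaces.Torus.partialDeriv i g) x)) +
        ∫ x, s τ x * g x)) (Icc 0 T) := fun hg =>
    continuousOn_const.add (continuousOn_primitive_Ioc
      ((h.integrable_mul_steadyFlux hg).integral_prod_left.add
        (h.integrable_source_mul_continuous hg.continuous).integral_prod_left))
  refine ae_eq_of_forall_mFourierCoeff_ofReal_eq (hw0.integrable one_le_two) hθ₀i fun k => ?_
  -- real part: the continuous coefficient agrees on `[0,T]` with the primitive of the cosine pairing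
  have hre : EqOn (fun t => (mFourierCoeff (fun x => (w t x : ℂ)) k).re)
      (fun t => (∫ x, θ₀ x * reTrigPoly {-k} (fun _ => (1 : ℂ)) x) +
        ∫ τ in Ioc 0 t, ((∫ x, θ τ x * (⟪u τ x, gradient (reTrigPoly {-k} (fun _ => (1 : ℂ))) x⟫_ℝ +
          κ * ∑ i, a i * FunctionSpaces.Torus.partialDeriv i
            (FunctionSpaces.Torus.partialDeriv i (reTrigPoly {-k} (fun _ => (1 : ℂ)))) x)) +
          ∫ x, s τ x * reTrigPoly {-k} (fun _ => (1 : ℂ)) x)) (Icc 0 T) := by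
    refine eqOn_Icc_of_ae_Ioo (Y := ℝ) hT (Complex.continuous_re.comp_continuousOn (hwc k))
      (hPc (isSmooth_reTrigPoly _ _)) ?_
    filter_upwards [h.ae_integral_mul_eq (isSmooth_reTrigPoly {-k} fun _ => (1 : ℂ)), hwae,
      h.ae_memLp_two] with t ht hwt hθt
    have e : mFourierCoeff (fun x => (w t x : ℂ)) k = mFourierCoeff (fun x => (θ t x : ℂ)) k :=
      mFourierCoeff_congr_ae (hwt.mono fun x hx => by simp only [hx]) k
    show (mFourierCoeff (fun x => (w t x : ℂ)) k).re = _
    rw [e, re_mFourierCoeff_ofReal (hθt.integrable one_le_two) k]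
    exact ht
  -- imaginary part: the same with the sine pairing
  have him : EqOn (fun t => (mFourierCoeff (fun x => (w t x : ℂ)) k).im)
      (fun t => (∫ x, θ₀ x * reTrigPoly {-k} (fun _ => -Complex.I) x) +
        ∫ τ in Ioc 0 t, ((∫ x, θ τ x * (⟪u τ x, gradient (reTrigPoly {-k} (fun _ => -Complex.I)) x⟫_ℝ +
          κ * ∑ i, a i * FunctionSpaces.Torus.partialDeriv i
            (FunctionSpaces.Torus.partialDeriv i (reTrigPoly {-k} (fun _ => -Complex.I))) x)) +
          ∫ x, s τ x * reTrigPoly {-k} (fun _ => -Complex.I) x)) (Icc 0 T) := by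
    refine eqOn_Icc_of_ae_Ioo (Y := ℝ) hT (Complex.continuous_im.comp_continuousOn (hwc k))
      (hPc (isSmooth_reTrigPoly _ _)) ?_
    filter_upwards [h.ae_integral_mul_eq (isSmooth_reTrigPoly {-k} fun _ => -Complex.I), hwae,
      h.ae_memLp_two] with t ht hwt hθt
    have e : mFourierCoeff (fun x => (w t x : ℂ)) k = mFourierCoeff (fun x => (θ t x : ℂ)) k :=
      mFourierCoeff_congr_ae (hwt.mono fun x hx => by simp only [hx]) k
    show (mFourierCoeff (fun x => (w t x : ℂ)) k).im = _
    rw [e, im_mFourierCoeff_ofReal (hθt.integrable one_le_two) k]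
    exact ht
  have h0 : (0 : ℝ) ∈ Icc 0 T := left_mem_Icc.2 hT.le
  have hre0 := hre h0
  have him0 := him h0
  simp only [Ioc_self, Measure.restrict_empty, integral_zero_measure, add_zero] at hre0 him0
  refine Complex.ext ?_ ?_
  · rw [hre0, re_mFourierCoeff_ofReal hθ₀i k]
  · rw [him0, im_mFourierCoeff_ofReal hθ₀i k]

end IsWeakScalarTransportDiagForcedOn

end Torus

end Literature.Analysis.FluidPDE

end
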